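import Literature.IUT.HodgeArakelov.AbsTopMonoidsGenuineGhatTransport
import Literature.IUT.HodgeArakelov.AbsTopMonoidsGenuineIsometries
import Literature.IUT.HodgeArakelov.GaloisPairRigidity
import Literature.AnabelianGeometry.AbsoluteAnabelian.MLFClosureUnitsAnchorProofs
import HarnessLib

/-!
# [IUTchII] Example 1.8 (vii) `(∗ĝp)` GENUINE, part 3: the interface `ProfiniteGroupifications` INHABITED at the
# all-fields-genuine producer by `O^ĝp(G) = lim→_J ((k̄^×)^J)^∧`; Remark 1.11.1 (i) (c) clauses (1) and (3) PROVED there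

S. Mochizuki, *Inter-universal Teichmüller theory II*, §1, Example 1.8 (vii) p. 40 ("`(∗ĝp)` … `(G ↷ O^ĝp(G))` …
compatible with a natural action of `Γ`"; "`α_ĝp` … compatible … with the poly-isomorphism `α_×` of (iii)") and Remark
1.11.1 (i) (c) p. 50 ("the group of automorphisms of … `G ↷ O^ĝp(G)` maps surjectively [i.e., by forgetting `O^ĝp(G)`]
onto the group of automorphisms of the topological group `G`, with kernel given by the [`G`-linear] automorphisms …
determined by the natural action of `Ẑ^×`") [claim: Mochizuki2012, status: disputed] (IUTchII §1 Ex 1.8 (vii), kurims p.40).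
abc-iut cell, layer L6, row «GHATGP-GENUINE» (L6-lead GO 2026-08-26T10:5xZ), STAGE 2 (seat abc-iut-L6-d2 gen 6; post-freeze
def, reading (ii)); over `AbsTopMonoidsGenuineGhat(Transport).lean` (stages 1b/1c) and abc-iut-L6-d2's all-fields-genuine
producer `AbsTopMonoids.genuineOfModelIsm S C ε hΔ hq` (`O^⊳(G) = 𝒪_k̄^⊳`, `O^⊳(f) =` THE lift `liftM`).

* `Genuine.toUnitHom` / `ounitsToUnits` (`𝒪_k̄^⊳ → k̄^×`, `(𝒪_k̄^⊳)ˣ → k̄^×`, injective), `Genuine.unitsLocalizationMap`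
  — `k̄^× = (𝒪_k̄^⊳)^gp` as a Mathlib `LocalizationMap` at `⊤` (abc-iut-w6-d016's construction in
  `GaloisPairRigidityGpKernelGenuine`, here as a def: every `x ∈ k̄^×` has `x` or `x⁻¹` in `𝒪_k̄^⊳`,
  `MLFClosure.mem_nonzeroIntegers_or_inv_mem`);
* **`Genuine.liftUnits C φ : k̄^× ≃* k̄^×`** — the GROUPIFICATION of the lift `liftM(φ)` of a topological automorphism `φ`
  of `Gal(k̄/k)` (`liftUnits_toUnitHom`), `φ`-EQUIVARIANT (`isEquivariantUnits_liftUnits`, from `liftM_spec` by the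
  universal property `LocalizationMap.epic_of_localizationMap`);
* **`AbsTopMonoids.genuineGhat : ProfiniteGroupifications (genuineOfModelIsm S C ε hΔ hq) ZHatUnits`** — the GENUINE
  `(∗ĝp)`: `O^ĝp(G) := Genuine.Oghat C`; `O^×(G) ↪ O^ĝp(G)` = `η ∘ ((𝒪_k̄^⊳)ˣ ↪ k̄^×)`, INJECTIVE (`toOghat_injective`);
  `M^ĝp_TM(Π) :=` the same ind-completion of `M_TM(Π)^gp = k̄^×` with `M_TM(Π) = 𝒪_k̄^⊳ → O^ĝp`; the NATURAL
  `Γ = Ẑ^×`-actions `zhatPowOghat`; `α_ĝp := id` (`(∗TM⊳) = id` at the producer), `alphaGhat_compat` definitional;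
* **`AbsTopMonoids.genuineGhatAct G : G.G →* MulAut O^ĝp(G)`** — the `G`-action (`g` acts by the transport along
  `theta(g) ∈ Gal(k̄/k)`), EXTENDING the `G`-action on `O^×(G)` (`genuineGhatAct_unitsToOghat`);
* Remark 1.11.1 (i) (c) for `Rmk1111_c (genuineOfModelIsm …) genuineGhat genuineGhatAct (fun _ => zhatPowOghat C)`:
  **clause (3) PROVED** `genuineGhat_zhatPow_mem_pairAut` (every `x ↦ x^u` is `G`-linear) and **clause (1) PROVED**
  `genuineGhat_forget_surjective` (every `σ ∈ Aut(G)` lifts to the pair automorphism `(σ, (liftM(φ_σ)^gp)^)`).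
  Clause (2) (the kernel consists of `Ẑ^×`-powers ONLY — the Kummer argument of [AbsTopIII] Prop. 3.3 (ii) on `O^ĝp`) is
  the sequel (STAGE 3); in the `(∗ĝp) := (∗gp)` reading it FAILS (kernel `{±1}`, abc-iut-w6-d016 p431190) — the reason the
  genuine completion is needed.

HONEST FRAMING: classical algebra over OUR typed objects, every input PROVED in the tree (liftM: abc-iut-L6-t13/L6-d2 via
[AbsTopIII] Prop. 3.2 (iv)); record-anchored to a disputed corpus through the locators only; nothing here bears on
[IUTchIII] Cor. 3.12; typed ≠ proved elsewhere; ind-topologies not modelled (interface convention).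
-/

set_option autoImplicit false

noncomputable section

namespace Literature.IUT.HodgeArakelov

open CategoryTheory
open Literature.AnabelianGeometry.AbsoluteAnabelian

namespace AbsTopMonoids.Genuine

variable (C : MLFClosure.{0})

/-! ## `𝒪_k̄^⊳ ⊆ k̄^×` and the localisation `(𝒪_k̄^⊳)^gp = k̄^×` -/

/-- `𝒪_k̄^⊳ → k̄^×`, `m ↦ m`, as a monoid homomorphism. [claim: Mochizuki2012, status: disputed] (IUTchII §1 Ex 1.8 (vii), kurims p.40) -/
def toUnitHom : nonzeroIntegers C.k C.K →* (C.K)ˣ where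
  toFun := ModelMLFGaloisData.toUnit
  map_one' := Units.ext rfl
  map_mul' := ModelMLFGaloisData.toUnit_mul

/-- `coe_toUnitHom` (structure lemma of the genuine `(∗ĝp)` construction). [claim: Mochizuki2012, status: disputed] (IUTchII §1 Ex 1.8 (vii), kurims p.40) -/
@[simp] theorem coe_toUnitHom (m : nonzeroIntegers C.k C.K) : ((toUnitHom C m : (C.K)ˣ) : C.K) = m := rfl

/-- `O^×(G) = (𝒪_k̄^⊳)ˣ → k̄^×`, `u ↦ u`. [claim: Mochizuki2012, status: disputed] (IUTchII §1 Ex 1.8 (vii), kurims p.40) -/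
def ounitsToUnits : (nonzeroIntegers C.k C.K)ˣ →* (C.K)ˣ := (toUnitHom C).comp (Units.coeHom _)

/-- `coe_ounitsToUnits` (structure lemma of the genuine `(∗ĝp)` construction). [claim: Mochizuki2012, status: disputed] (IUTchII §1 Ex 1.8 (vii), kurims p.40) -/
@[simp] theorem coe_ounitsToUnits (u : (nonzeroIntegers C.k C.K)ˣ) :
    ((ounitsToUnits C u : (C.K)ˣ) : C.K) = ((u : nonzeroIntegers C.k C.K) : C.K) := rfl

/-- `ounitsToUnits_injective` (structure lemma of the genuine `(∗ĝp)` construction). [claim: Mochizuki2012, status: disputed] (IUTchII §1 Ex 1.8 (vii), kurims p.40) -/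
theorem ounitsToUnits_injective : Function.Injective (ounitsToUnits C) := fun _ _ h =>
  Units.ext (Subtype.ext (congrArg (fun w : (C.K)ˣ => (w : C.K)) h))

/-- `𝒪_k̄^⊳ → k̄^×` is a LOCALISATION at `⊤`, i.e. `k̄^× = (𝒪_k̄^⊳)^gp` (every `x ∈ k̄^×` has `x ∈ 𝒪_k̄^⊳` or `x⁻¹ ∈ 𝒪_k̄^⊳`:
abc-iut-L6's `MLFClosure.mem_nonzeroIntegers_or_inv_mem`; abc-iut-w6-d016 `genuineOfModel_exists_ogpEquiv`).
[claim: Mochizuki2012, status: disputed] (IUTchII §1 Ex 1.8 (vii), kurims p.40) -/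
def unitsLocalizationMap : (⊤ : Submonoid (nonzeroIntegers C.k C.K)).LocalizationMap (C.K)ˣ :=
  { toFun := toUnitHom C
    map_mul' := map_mul _
    isLocalizationMap :=
      { map_units := fun y => Group.isUnit _
        surj := fun z => by
          rcases C.mem_nonzeroIntegers_or_inv_mem z.ne_zero with hz | hz
          · exact ⟨(⟨(z : C.K), hz⟩, 1), Units.ext (by simp [toUnitHom])⟩
          · refine ⟨(1, ⟨⟨((z : C.K))⁻¹, hz⟩, trivial⟩), Units.ext ?_⟩
            simp [toUnitHom]
        exists_of_eq := fun {x y} h => ⟨1, by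
          have h' : (x : C.K) = (y : C.K) := congrArg (fun u : (C.K)ˣ => (u : C.K)) h
          rw [Subtype.ext h']⟩ } }

/-- `unitsLocalizationMap_apply` (structure lemma of the genuine `(∗ĝp)` construction). [claim: Mochizuki2012, status: disputed] (IUTchII §1 Ex 1.8 (vii), kurims p.40) -/
@[simp] theorem unitsLocalizationMap_apply (m : nonzeroIntegers C.k C.K) :
    unitsLocalizationMap C m = toUnitHom C m := rfl

/-! ## The lift `liftM(φ)` groupified: a `φ`-equivariant automorphism of `k̄^×` -/

/-- **`liftM(φ)^gp : k̄^× ⥲ k̄^×`** — the groupification of THE `φ`-equivariant lift `liftM(φ) : 𝒪_k̄^⊳ ⥲ 𝒪_k̄^⊳` of a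
topological automorphism `φ` of `Gal(k̄/k)` ([IUTchII] Ex. 1.8 (ii)/(vii): "`(∗^gp)`"). [claim: Mochizuki2012, status: disputed] (IUTchII §1 Ex 1.8 (vii), kurims p.40) -/
def liftUnits (φ : (C.K ≃ₐ[C.k] C.K) ≃ₜ* (C.K ≃ₐ[C.k] C.K)) : (C.K)ˣ ≃* (C.K)ˣ :=
  (unitsLocalizationMap C).mulEquivOfMulEquiv (unitsLocalizationMap C) (j := liftM C φ)
    (top_le_iff.mp fun x _ => ⟨(liftM C φ).symm x, trivial, (liftM C φ).apply_symm_apply x⟩)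

/-- `liftUnits_toUnitHom` (structure lemma of the genuine `(∗ĝp)` construction). [claim: Mochizuki2012, status: disputed] (IUTchII §1 Ex 1.8 (vii), kurims p.40) -/
theorem liftUnits_toUnitHom (φ : (C.K ≃ₐ[C.k] C.K) ≃ₜ* (C.K ≃ₐ[C.k] C.K)) (m : nonzeroIntegers C.k C.K) :
    liftUnits C φ (toUnitHom C m) = toUnitHom C (liftM C φ m) :=
  (unitsLocalizationMap C).mulEquivOfMulEquiv_eq
    (top_le_iff.mp fun x _ => ⟨(liftM C φ).symm x, trivial, (liftM C φ).apply_symm_apply x⟩) m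

/-- `liftM(φ)^gp` is `φ`-EQUIVARIANT on `k̄^×` (from `liftM_spec` on `𝒪_k̄^⊳`, by the universal property of the
localisation). [claim: Mochizuki2012, status: disputed] (IUTchII §1 Ex 1.8 (vii), kurims p.40) -/
theorem isEquivariantUnits_liftUnits (φ : (C.K ≃ₐ[C.k] C.K) ≃ₜ* (C.K ≃ₐ[C.k] C.K)) :
    IsEquivariantUnits C φ (liftUnits C φ) := by
  intro σ x
  have key : ((liftUnits C φ).toMonoidHom.comp (galUnits C σ)) = (galUnits C (φ σ)).comp (liftUnits C φ).toMonoidHom := by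
    refine (unitsLocalizationMap C).epic_of_localizationMap (MonoidHom.ext fun m => ?_)
    let σ' : (ModelMLFGaloisData.galois C.k C.K).tmPair.Pi := σ
    change liftUnits C φ (galUnits C σ (toUnitHom C m)) = galUnits C (φ σ') (liftUnits C φ (toUnitHom C m))
    have h1 : galUnits C σ (toUnitHom C m) = toUnitHom C (σ' • m) := Units.ext rfl
    rw [h1, liftUnits_toUnitHom, liftUnits_toUnitHom]
    apply Units.ext
    change ((liftM C φ (σ' • m) : nonzeroIntegers C.k C.K) : C.K) =
      ((ModelMLFGaloisData.galois C.k C.K).aug (φ σ')) ((liftM C φ m : nonzeroIntegers C.k C.K) : C.K)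
    rw [liftM_spec, ModelMLFGaloisData.nonzeroIntegers_coe_smul]
    rfl
  exact DFunLike.congr_fun key x

/-- Equivariance data compose. [claim: Mochizuki2012, status: disputed] (IUTchII §1 Ex 1.8 (vii), kurims p.40) -/
theorem IsEquivariantUnits.trans {φ₁ φ₂ : (C.K ≃ₐ[C.k] C.K) ≃ₜ* (C.K ≃ₐ[C.k] C.K)} {τ₁ τ₂ : (C.K)ˣ ≃* (C.K)ˣ}
    (h₁ : IsEquivariantUnits C φ₁ τ₁) (h₂ : IsEquivariantUnits C φ₂ τ₂) :
    IsEquivariantUnits C (φ₁.trans φ₂) (τ₁.trans τ₂) := fun σ x => by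
  rw [MulEquiv.trans_apply, h₁, h₂]
  rfl

end AbsTopMonoids.Genuine

/-! ## The interface `ProfiniteGroupifications` inhabited by the GENUINE `(∗ĝp)` -/

section Inhabitant

open AbsTopMonoids AbsTopMonoids.Genuine

variable (S : ThetaSetting.{0}) (C : MLFClosure.{0}) (ε : S.Gk ≃ₜ* (ModelMLFGaloisData.galois C.k C.K).tmPair.Pi)
  (hΔ : ∀ f : S.PiX ≃ₜ* S.PiX, S.DeltaX.map f.toMulEquiv.toMonoidHom = S.DeltaX)
  (hq : Nonempty (TopGroup.quot S.PiX S.DeltaX ≃ₜ* S.Gk))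

/-- **[IUTchII] Ex. 1.8 (vii) `(∗ĝp)` GENUINE at the all-fields-genuine producer**: `ProfiniteGroupifications` inhabited with
`O^ĝp(G) := lim→_J ((k̄^×)^J)^∧` (`Genuine.Oghat C`), `O^×(G) = (𝒪_k̄^⊳)ˣ ↪ k̄^× ↪ O^ĝp` (`η`, INJECTIVE), `M^ĝp_TM(Π) :=` the same
ind-completion of `M_TM(Π)^gp = k̄^×` with `M_TM(Π) = 𝒪_k̄^⊳ → O^ĝp`, the NATURAL `Γ = Ẑ^×`-actions (`zhatPowOghat`), and
`α_ĝp := id` (`(∗TM⊳) = id` at the producer), compatible with `α_×` on units. [claim: Mochizuki2012, status: disputed] (IUTchII §1 Ex 1.8 (vii), kurims p.40) -/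
def AbsTopMonoids.genuineGhat : ProfiniteGroupifications (AbsTopMonoids.genuineOfModelIsm S C ε hΔ hq) ZHatUnits where
  Oghat _ := Genuine.Oghat C
  unitsToOghat _ := (toOghat C).comp (ounitsToUnits C)
  unitsToOghat_injective _ := (toOghat_injective C).comp (ounitsToUnits_injective C)
  Mghat _ := Genuine.Oghat C
  toMghat _ := (toOghat C).comp (toUnitHom C)
  actΓO _ := zhatPowOghat C
  actΓM _ := zhatPowOghat C
  alphaGhat _ := MulEquiv.refl _
  alphaGhat_compat _ _ := congrArg (toOghat C) (Units.ext rfl)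

/-- `O^ĝp(G)` of the genuine `(∗ĝp)` IS `lim→_J ((k̄^×)^J)^∧` (definitionally). [claim: Mochizuki2012, status: disputed] (IUTchII §1 Ex 1.8 (vii), kurims p.40) -/
theorem AbsTopMonoids.genuineGhat_Oghat (G : IsoClass S.Gk) :
    (AbsTopMonoids.genuineGhat S C ε hΔ hq).Oghat G = Genuine.Oghat C := rfl

/-- **The `G`-action on `O^ĝp(G)`** at the genuine `(∗ĝp)`: `g` acts by the transport along `theta(g) ∈ Gal(k̄/k)`.
[claim: Mochizuki2012, status: disputed] (IUTchII §1 Ex 1.8 (vii), kurims p.40) -/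
def AbsTopMonoids.genuineGhatAct (G : IsoClass S.Gk) : G.G →* MulAut (Genuine.Oghat C) :=
  (galActOghat C).comp (theta C ε G).toMulEquiv.toMonoidHom

/-- `AbsTopMonoids.genuineGhatAct_apply` (structure lemma of the genuine `(∗ĝp)` construction). [claim: Mochizuki2012, status: disputed] (IUTchII §1 Ex 1.8 (vii), kurims p.40) -/
theorem AbsTopMonoids.genuineGhatAct_apply (G : IsoClass S.Gk) (g : G.G) (z : Genuine.Oghat C) :
    AbsTopMonoids.genuineGhatAct S C ε G g z = galActOghat C (theta C ε G g) z := rfl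

/-- The `G`-action on `O^ĝp(G)` EXTENDS the `G`-action on `O^×(G)` along `O^×(G) ↪ O^ĝp(G)` (the pair `G ↷ O^ĝp(G)` restricts to
`G ↷ O^×(G)`). [claim: Mochizuki2012, status: disputed] (IUTchII §1 Ex 1.8 (vii), kurims p.40) -/
theorem AbsTopMonoids.genuineGhatAct_unitsToOghat (G : IsoClass S.Gk) (g : G.G)
    (u : (AbsTopMonoids.genuineOfModelIsm S C ε hΔ hq).Ounits G) :
    AbsTopMonoids.genuineGhatAct S C ε G g ((AbsTopMonoids.genuineGhat S C ε hΔ hq).unitsToOghat G u) =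
      (AbsTopMonoids.genuineGhat S C ε hΔ hq).unitsToOghat G
        ((AbsTopMonoids.genuineOfModelIsm S C ε hΔ hq).actOunits G g u) := by
  change galActOghat C (theta C ε G g) (toOghat C (ounitsToUnits C u)) = toOghat C (ounitsToUnits C _)
  rw [galActOghat_toOghat]
  exact congrArg (toOghat C) (Units.ext rfl)

/-- **IUTchII:Rmk1.11.1(i) (c), THIRD CLAUSE, at the genuine `(∗ĝp)`**: every `Ẑ^×`-power `x ↦ x^u` of `O^ĝp(G)` is
`G`-LINEAR, i.e. `(1, (·)^u)` is an automorphism of the pair `G ↷ O^ĝp(G)`. [claim: Mochizuki2012, status: disputed] (IUTchII §1 Rmk 1.11.1 (i), kurims p.50) -/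
theorem AbsTopMonoids.genuineGhat_zhatPow_mem_pairAut (G : IsoClass S.Gk) (u : ZHatUnits) :
    ((1 : Aut G), zhatPowOghat C u) ∈
      PairAut G ((AbsTopMonoids.genuineGhat S C ε hΔ hq).Oghat G) (AbsTopMonoids.genuineGhatAct S C ε G) := by
  intro g m
  change zhatPowOghat C u (galActOghat C (theta C ε G g) m) = galActOghat C (theta C ε G g) (zhatPowOghat C u m)
  exact (galActOghat_zhatPowOghat C _ u m).symm

/-- **IUTchII:Rmk1.11.1(i) (c), FIRST CLAUSE, at the genuine `(∗ĝp)`**: `Aut(G ↷ O^ĝp(G)) → Aut(G)` is SURJECTIVE — every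
`σ ∈ Aut(G)` lifts to the pair automorphism `(σ, (liftM(φ_σ)^gp)^)` (transport of `O^ĝp` along the groupified equivariant lift).
[claim: Mochizuki2012, status: disputed] (IUTchII §1 Rmk 1.11.1 (i), kurims p.50) -/
theorem AbsTopMonoids.genuineGhat_forget_surjective (G : IsoClass S.Gk) :
    Function.Surjective (PairAut.forget (G := G)
      (M := (AbsTopMonoids.genuineGhat S C ε hΔ hq).Oghat G) (act := AbsTopMonoids.genuineGhatAct S C ε G)) := by
  intro σ
  let φ := phiOf C ε σ.hom
  have hτ := isEquivariantUnits_liftUnits C φ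
  refine ⟨⟨(σ, transportOghatEquiv C hτ), fun g m => ?_⟩, rfl⟩
  let t : C.K ≃ₐ[C.k] C.K := theta C ε G g
  change transportOghat C φ (liftUnits C φ) hτ (galActOghat C t m) =
    galActOghat C (theta C ε G (IsoClass.homIso σ.hom g)) (transportOghat C φ (liftUnits C φ) hτ m)
  have hφg : theta C ε G (IsoClass.homIso σ.hom g) = φ t := by
    change _ = theta C ε G (IsoClass.homIso σ.hom ((theta C ε G).symm (theta C ε G g)))
    rw [ContinuousMulEquiv.symm_apply_apply]
  rw [hφg, galActOghat_apply, galActOghat_apply,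
    ← transportOghat_comp_apply C (isEquivariantUnits_gal C t) hτ
      ((isEquivariantUnits_gal C t).trans C hτ) (fun _ => rfl) (fun _ => rfl) m,
    ← transportOghat_comp_apply C hτ (isEquivariantUnits_gal C (φ t))
      ((isEquivariantUnits_gal C t).trans C hτ) ?_ ?_ m]
  · intro γ
    have key : ∀ a b : (ModelMLFGaloisData.galois C.k C.K).tmPair.Pi, φ (a * b * a⁻¹) = φ a * φ b * (φ a)⁻¹ :=
      fun a b => by rw [map_mul, map_mul, map_inv]
    exact key t γ
  · intro x
    exact hτ t x

end Inhabitant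

end Literature.IUT.HodgeArakelov

end
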